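import Summits.CriticalPhenomena.SAWScalingLimit.Theorems.SAWDevelopingMapHexConjectureMarginalWedgeDefs
import Literature.Probability.RandomPlanarGeometry.HexParafermionProofs

/-!
# The flux line of the marginal reflex wedge (`stub_reflexFluxLine`)

Crux `stmt-CriticalPhenomena-0808` (`HexConjecture` = Duminil-Copin–Smirnov 2012, Conjecture 1),
line `marginal-reflex-wedge-cauchy-kernel`, registered stub `stub_reflexFluxLine` (statement `G → FluxLine`:
the antecedent `G` is the geometry of the truncated `300°` wedge `W_N`, supplied by the neighbouring stub
`stub_reflexWedgeGeometry` and taken here as a hypothesis).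

Conclusion (the FLUX LINE of `W_N`, `1 ≤ N`, `IsReflexWedgeTruncation Λ N`):
`farFlux Λ N = (1/(2√3)) · (−i − e^{−iπ/8} · (rayZeroMass Λ N − raySixtyMass Λ N))`.

Mechanism [cite: DuminilCopinSmirnov2012, §3 (proof of Lemma 2, eq. (2))]: Lemma 1 of DCS (PROVED,
`DuminilCopinSmirnov2012_lemma1_holds`) says the corner-rooted critical observable `Fc Λ (5/8)` satisfies
the vertex relations of `Λ`; the discrete Green identity of the barrier file
(`hexFlux_eq_zero_of_satisfiesVertexRelations`) makes its boundary flux vanish; the boundary darts of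
`W_N` split into the root dart, the `0°`-ray darts, the `60°`-ray darts and the arc darts
(`FluxLine.hexFlux_decomp`); the root term is `i/(2√3)` (`F(a) = 1`), and on the two rays the winding
is rigid (`π`, resp. `−5π/3`, from `G`), so the terms are `(1/(2√3)) e^{−iπ/8} ‖F‖`, resp.
`−(1/(2√3)) e^{−iπ/8} ‖F‖` (`FluxLine.term_rayZero`, `FluxLine.term_raySixty`); solving the linear
identity for the arc flux gives the line. No unproved named fact is used.
-/

noncomputable section

open scoped BigOperators Classical
open Literature.Probability.LatticeModels Literature.Probability.RandomPlanarGeometry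
  Literature.Probability.RandomPlanarGeometry.SAW
open Literature.Barriers.CriticalPhenomena.HexGreen (nbrs)

namespace Summit.CriticalPhenomena.SAWScalingLimit.Theorems.HexConjecture.MarginalWedge

open Literature.Barriers.CriticalPhenomena Literature.Barriers.CriticalPhenomena.HexGreen
open Literature.Barriers.CriticalPhenomena.HexKernel (term)

namespace FluxLine

/-! ### Bookkeeping on `dartSum` -/

/-- The boundary flux of the barrier file is the dart sum over ALL boundary darts (any
everywhere-true selector `P`). [folklore] -/
theorem hexFlux_eq_dartSum (Λ : Finset HexVertex) (F : Sym2 HexVertex → ℂ)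
    {P : HexVertex → HexVertex → Prop} (hP : ∀ v w, P v w) :
    hexFlux Λ F = dartSum Λ P (term F) := by
  unfold hexFlux dartSum
  refine Finset.sum_congr rfl fun v _ => Finset.sum_congr ?_ fun _ _ => rfl
  exact Finset.filter_congr fun w _ => (and_iff_left (hP v w)).symm

/-- Splitting a dart sum into two classes that partition the selected boundary darts. [folklore] -/
theorem dartSum_add {M : Type*} [AddCommMonoid M] {Λ : Finset HexVertex}
    {P Q R : HexVertex → HexVertex → Prop}
    (hiff : ∀ v ∈ Λ, ∀ w, hexGraph.Adj v w → w ∉ Λ → (P v w ↔ Q v w ∨ R v w))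
    (hdisj : ∀ v ∈ Λ, ∀ w, hexGraph.Adj v w → w ∉ Λ → Q v w → ¬ R v w)
    (f : HexVertex → HexVertex → M) :
    dartSum Λ P f = dartSum Λ Q f + dartSum Λ R f := by
  unfold dartSum
  rw [← Finset.sum_add_distrib]
  refine Finset.sum_congr rfl fun v hv => ?_
  have hdis : Disjoint ((nbrs v).filter fun w => w ∉ Λ ∧ Q v w)
      ((nbrs v).filter fun w => w ∉ Λ ∧ R v w) := by
    rw [Finset.disjoint_filter]
    intro w hw hQ hR
    exact hdisj v hv w ((mem_nbrs_iff v w).1 hw) hQ.1 hQ.2 hR.2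
  rw [← Finset.sum_union hdis]
  refine Finset.sum_congr ?_ fun _ _ => rfl
  ext w
  simp only [Finset.mem_union, Finset.mem_filter]
  constructor
  · rintro ⟨hw, hwΛ, hPw⟩
    rcases (hiff v hv w ((mem_nbrs_iff v w).1 hw) hwΛ).1 hPw with h | h
    · exact Or.inl ⟨hw, hwΛ, h⟩
    · exact Or.inr ⟨hw, hwΛ, h⟩
  · rintro (⟨hw, hwΛ, h⟩ | ⟨hw, hwΛ, h⟩)
    · exact ⟨hw, hwΛ, (hiff v hv w ((mem_nbrs_iff v w).1 hw) hwΛ).2 (Or.inl h)⟩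
    · exact ⟨hw, hwΛ, (hiff v hv w ((mem_nbrs_iff v w).1 hw) hwΛ).2 (Or.inr h)⟩

/-- Dart sums only depend on the summand on the selected boundary darts. [folklore] -/
theorem dartSum_congr_fun {M : Type*} [AddCommMonoid M] {Λ : Finset HexVertex}
    {P : HexVertex → HexVertex → Prop} {f g : HexVertex → HexVertex → M}
    (h : ∀ v ∈ Λ, ∀ w, hexGraph.Adj v w → w ∉ Λ → P v w → f v w = g v w) :
    dartSum Λ P f = dartSum Λ P g := by
  unfold dartSum
  refine Finset.sum_congr rfl fun v hv => Finset.sum_congr rfl fun w hw => ?_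
  rw [Finset.mem_filter] at hw
  exact h v hv w ((mem_nbrs_iff v w).1 hw.1) hw.2.1 hw.2.2

/-- Constants come out of dart sums. [folklore] -/
theorem dartSum_const_mul {Λ : Finset HexVertex} {P : HexVertex → HexVertex → Prop} (c : ℂ)
    (g : HexVertex → HexVertex → ℂ) :
    dartSum Λ P (fun v w => c * g v w) = c * dartSum Λ P g := by
  unfold dartSum
  rw [Finset.mul_sum]
  exact Finset.sum_congr rfl fun v _ => (Finset.mul_sum _ _ c).symm

/-- Real dart sums cast to `ℂ`. [folklore] -/
theorem ofReal_dartSum {Λ : Finset HexVertex} {P : HexVertex → HexVertex → Prop}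
    (g : HexVertex → HexVertex → ℝ) :
    ((dartSum Λ P g : ℝ) : ℂ) = dartSum Λ P fun v w => (g v w : ℂ) := by
  unfold dartSum
  push_cast
  rfl

/-- The dart sum over the single ROOT dart `(cornerIn, cornerOut)`. [folklore] -/
theorem dartSum_root {M : Type*} [AddCommMonoid M] {Λ : Finset HexVertex}
    {R : HexVertex → HexVertex → Prop} (f : HexVertex → HexVertex → M)
    (hin : cornerIn ∈ Λ) (hout : cornerOut ∉ Λ) (hadj : hexGraph.Adj cornerIn cornerOut)
    (hR : ∀ v ∈ Λ, ∀ w, hexGraph.Adj v w → w ∉ Λ → (R v w ↔ v = cornerIn ∧ w = cornerOut)) :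
    dartSum Λ R f = f cornerIn cornerOut := by
  unfold dartSum
  rw [Finset.sum_eq_single_of_mem cornerIn hin]
  · rw [Finset.sum_eq_single_of_mem cornerOut]
    · exact Finset.mem_filter.2
        ⟨(mem_nbrs_iff _ _).2 hadj, hout, (hR _ hin _ hadj hout).2 ⟨rfl, rfl⟩⟩
    · intro w hw hne
      rw [Finset.mem_filter] at hw
      exact absurd ((hR _ hin _ ((mem_nbrs_iff _ _).1 hw.1) hw.2.1).1 hw.2.2).2 hne
  · intro v hv hne
    refine Finset.sum_eq_zero fun w hw => ?_
    rw [Finset.mem_filter] at hw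
    exact absurd ((hR v hv w ((mem_nbrs_iff _ _).1 hw.1) hw.2.1).1 hw.2.2).1 hne

/-! ### Rigid phases -/

/-- If every walk to `z` has the same winding `W`, the observable at `z` is `e^{-iσW} ‖F(z)‖`.
[cite: DuminilCopinSmirnov2012, §3 (proof of Lemma 2: "The winding of any self-avoiding walk
from a to the top part of the boundary is …")] -/
theorem obs_eq_exp_mul_norm {Λ : Finset HexVertex} {a z : Sym2 HexVertex} {x : ℝ} (hx : 0 ≤ x)
    (σ W : ℝ) (hW : ∀ γ : HexMidEdgeSAW Λ a z, γ.winding = W) :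
    hexParafermionicObservable Λ a x σ z =
      Complex.exp (-Complex.I * σ * W) * (‖hexParafermionicObservable Λ a x σ z‖ : ℂ) := by
  have hsum : hexParafermionicObservable Λ a x σ z =
      Complex.exp (-Complex.I * σ * W) * ((∑ γ : HexMidEdgeSAW Λ a z, x ^ γ.length : ℝ) : ℂ) := by
    rw [hexParafermionicObservable_def, Complex.ofReal_sum, Finset.mul_sum]
    refine Finset.sum_congr rfl fun γ _ => ?_
    rw [HexMidEdgeSAW.weight, hW γ, Complex.ofReal_pow]
  have hnn : 0 ≤ ∑ γ : HexMidEdgeSAW Λ a z, x ^ γ.length :=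
    Finset.sum_nonneg fun γ _ => pow_nonneg hx _
  have hnorm : ‖Complex.exp (-Complex.I * σ * W)‖ = 1 := by
    rw [show -Complex.I * σ * W = ((-(σ * W) : ℝ) : ℂ) * Complex.I by push_cast; ring]
    exact Complex.norm_exp_ofReal_mul_I _
  rw [hsum, norm_mul, hnorm, one_mul, Complex.norm_real, Real.norm_of_nonneg hnn]

/-! ### The corner edge (coordinates) -/

/-- `Re c(cornerIn) = 1/2`. [folklore] -/
theorem re_cornerIn : (hexCenter cornerIn).re = 1 / 2 := by
  simp [cornerIn, hexCenter, triEmbed]; norm_num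

/-- `Re c(cornerOut) = 1/2`. [folklore] -/
theorem re_cornerOut : (hexCenter cornerOut).re = 1 / 2 := by
  simp [cornerOut, hexCenter, triEmbed]; norm_num

/-- `Im c(cornerIn) = -√3/6`. [folklore] -/
theorem im_cornerIn : (hexCenter cornerIn).im = -(Real.sqrt 3 / 6) := by
  simp [cornerIn, hexCenter, triEmbed]; ring

/-- `Im c(cornerOut) = √3/6`. [folklore] -/
theorem im_cornerOut : (hexCenter cornerOut).im = Real.sqrt 3 / 6 := by
  simp [cornerOut, hexCenter, triEmbed]; ring

/-- The root edge is the vertical edge of length `1/√3` at `1/2`: `c_out - c_in = i/√3`. [folklore] -/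
theorem cornerOut_sub_cornerIn :
    hexCenter cornerOut - hexCenter cornerIn = ((Real.sqrt 3)⁻¹ : ℝ) * Complex.I := by
  have h3 : Real.sqrt 3 ^ 2 = 3 := Real.sq_sqrt (by norm_num)
  have h0 : Real.sqrt 3 ≠ 0 := fun h => by rw [h] at h3; norm_num at h3
  apply Complex.ext
  · simp [re_cornerIn, re_cornerOut]
  · simp only [Complex.sub_im, im_cornerIn, im_cornerOut, Complex.mul_im, Complex.ofReal_re,
      Complex.ofReal_im, Complex.I_re, Complex.I_im, mul_zero, mul_one]
    field_simp
    linear_combination 2 * h3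

/-- Both root vertices lie at distance `1/√3 < 1` from the apex. [folklore] -/
theorem norm_corner_lt_one : ‖hexCenter cornerIn‖ < 1 ∧ ‖hexCenter cornerOut‖ < 1 := by
  have h3 : Real.sqrt 3 ^ 2 = 3 := Real.sq_sqrt (by norm_num)
  have key : ∀ z : ℂ, z.re = 1 / 2 → z.im ^ 2 = 1 / 12 → ‖z‖ < 1 := by
    intro z hre him
    rw [sq] at him
    rw [← pow_lt_one_iff_of_nonneg (norm_nonneg _) two_ne_zero, ← Complex.normSq_eq_norm_sq,
      Complex.normSq_apply, hre, him]
    norm_num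
  refine ⟨key _ re_cornerIn ?_, key _ re_cornerOut ?_⟩
  · rw [im_cornerIn, neg_sq, div_pow, h3]; norm_num
  · rw [im_cornerOut, div_pow, h3]; norm_num

/-- `arg c(cornerIn) < 0` (the inner root vertex lies below the `0°`-ray). [folklore] -/
theorem arg_cornerIn_neg : Complex.arg (hexCenter cornerIn) < 0 := by
  rw [Complex.arg_neg_iff, im_cornerIn, neg_lt_zero]
  exact div_pos (Real.sqrt_pos.2 (by norm_num)) (by norm_num)

/-- `cornerIn ∈ W_N` for `N ≥ 1`. [folklore] -/
theorem cornerIn_mem {Λ : Finset HexVertex} {N : ℝ} (hN : 1 ≤ N) (hΛ : IsReflexWedgeTruncation Λ N) :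
    cornerIn ∈ Λ :=
  (hΛ cornerIn).2 ⟨norm_corner_lt_one.1.trans_le hN, fun h => absurd h.1 (not_le.2 arg_cornerIn_neg)⟩

/-- `‖c(cornerOut)‖ < N` for `N ≥ 1` (the root is not an arc dart). [folklore] -/
theorem norm_cornerOut_lt {N : ℝ} (hN : 1 ≤ N) : ‖hexCenter cornerOut‖ < N :=
  norm_corner_lt_one.2.trans_le hN

/-- If the root edge is a boundary edge and `cornerIn ∈ Λ` then `cornerOut ∉ Λ`. [folklore] -/
theorem cornerOut_not_mem {Λ : Finset HexVertex} (hbd : cornerEdge ∈ hexDomainBoundary Λ)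
    (hin : cornerIn ∈ Λ) : cornerOut ∉ Λ := by
  obtain ⟨-, u, v, huv, hv, hu⟩ := hbd
  rcases Sym2.eq_iff.1 huv with ⟨h1, -⟩ | ⟨-, h2⟩
  · exact absurd (h1 ▸ hin) hu
  · exact h2 ▸ hu

/-- The root edge is an edge of `ℍ` when it is a boundary edge. [folklore] -/
theorem adj_corner {Λ : Finset HexVertex} (hbd : cornerEdge ∈ hexDomainBoundary Λ) :
    hexGraph.Adj cornerIn cornerOut :=
  (SimpleGraph.mem_edgeSet hexGraph).1 hbd.1

/-! ### The four classes of boundary darts -/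

/-- **Decomposition of the boundary flux of `W_N`** into the arc flux, the root term and the
two ray sums. [cite: DuminilCopinSmirnov2012, §3 (proof of Lemma 2, eq. (2))] -/
theorem hexFlux_decomp {Λ : Finset HexVertex} {N : ℝ} (hN : 1 ≤ N)
    (hΛ : IsReflexWedgeTruncation Λ N) (hbd : cornerEdge ∈ hexDomainBoundary Λ)
    (F : Sym2 HexVertex → ℂ) :
    hexFlux Λ F = dartSum Λ (IsArcDart N) (term F) +
      (term F cornerIn cornerOut + dartSum Λ (IsRayZeroDart N) (term F) +
        dartSum Λ (IsRaySixtyDart N) (term F)) := by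
  have hin : cornerIn ∈ Λ := cornerIn_mem hN hΛ
  have hout : cornerOut ∉ Λ := cornerOut_not_mem hbd hin
  have hadj : hexGraph.Adj cornerIn cornerOut := adj_corner hbd
  have hvout : ∀ v ∈ Λ,
      Complex.arg (hexCenter v) < 0 ∨ Real.pi / 3 < Complex.arg (hexCenter v) := by
    intro v hv
    have h := ((hΛ v).1 hv).2
    unfold InSector at h
    rcases not_and_or.1 h with h | h
    · exact Or.inl (not_le.1 h)
    · exact Or.inr (not_le.1 h)
  have hpi3 : (0 : ℝ) < Real.pi / 3 := div_pos Real.pi_pos (by norm_num)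
  have e1 : hexFlux Λ F = dartSum Λ (fun _ _ => True) (term F) :=
    hexFlux_eq_dartSum Λ F fun _ _ => trivial
  have e2 : dartSum Λ (fun _ _ => True) (term F) =
      dartSum Λ (IsArcDart N) (term F) + dartSum Λ (fun v w => ¬ IsArcDart N v w) (term F) :=
    dartSum_add (fun v _ w _ _ => by simpa using em _) (fun v _ w _ _ h => not_not.2 h) _
  have e3 : dartSum Λ (fun v w => ¬ IsArcDart N v w) (term F) =
      dartSum Λ (fun v w => ¬ IsArcDart N v w ∧ Complex.arg (hexCenter v) < 0) (term F) +
        dartSum Λ (IsRaySixtyDart N) (term F) := by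
    refine dartSum_add (fun v hv w _ _ => ⟨fun h => ?_, fun h => ?_⟩)
      (fun v _ w _ _ h1 h2 => lt_asymm (hpi3.trans h2.2) h1.2) _
    · rcases hvout v hv with h' | h'
      · exact Or.inl ⟨h, h'⟩
      · exact Or.inr ⟨not_le.1 h, h'⟩
    · rcases h with h | h
      · exact h.1
      · exact not_le.2 h.1
  have e4 : dartSum Λ (fun v w => ¬ IsArcDart N v w ∧ Complex.arg (hexCenter v) < 0) (term F) =
      dartSum Λ (fun v w => v = cornerIn ∧ w = cornerOut) (term F) +
        dartSum Λ (IsRayZeroDart N) (term F) := by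
    refine dartSum_add (fun v _ w _ _ => ⟨fun h => ?_, fun h => ?_⟩)
      (fun v _ w _ _ h1 h2 => h2.2.2 (by rw [h1.1, h1.2])) _
    · by_cases hr : v = cornerIn ∧ w = cornerOut
      · exact Or.inl hr
      · exact Or.inr ⟨not_le.1 h.1, h.2, fun heq => hr (Prod.mk.inj heq)⟩
    · rcases h with ⟨rfl, rfl⟩ | h
      · exact ⟨not_le.2 (norm_cornerOut_lt hN), arg_cornerIn_neg⟩
      · exact ⟨not_le.2 h.1, h.2.1⟩
  have e5 : dartSum Λ (fun v w => v = cornerIn ∧ w = cornerOut) (term F) = term F cornerIn cornerOut :=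
    dartSum_root _ hin hout hadj fun _ _ _ _ _ => Iff.rfl
  rw [e1, e2, e3, e4, e5]

/-! ### Evaluation of the three near classes -/

/-- ROOT: `(mid(a) - c_in) F(a) = i/(2√3)` since `F(a) = 1`.
[cite: DuminilCopinSmirnov2012, §3 (proof of Lemma 2, "F(a) = 1")] -/
theorem term_root {Λ : Finset HexVertex} (hbd : cornerEdge ∈ hexDomainBoundary Λ) :
    term (Fc Λ (5 / 8)) cornerIn cornerOut = (1 / (2 * Real.sqrt 3) : ℂ) * Complex.I := by
  have hF : Fc Λ (5 / 8) s(cornerIn, cornerOut) = 1 := hexParafermionicObservable_self hbd _ _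
  have hmid : hexMidpoint s(cornerIn, cornerOut) - hexCenter cornerIn =
      (hexCenter cornerOut - hexCenter cornerIn) / 2 := by
    rw [hexMidpoint_mk]; ring
  rw [term, hF, mul_one, hmid, cornerOut_sub_cornerIn, Complex.ofReal_inv]
  ring

/-- RAY `0°`: vertical dart `i/√3`, winding `π`, phase `i · e^{-i5π/8} = e^{-iπ/8}`.
[cite: DuminilCopinSmirnov2012, §3 (proof of Lemma 2)] -/
theorem term_rayZero {Λ : Finset HexVertex} {v w : HexVertex}
    (hvec : hexCenter w - hexCenter v = ((Real.sqrt 3)⁻¹ : ℝ) * Complex.I)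
    (hW : ∀ γ : HexMidEdgeSAW Λ cornerEdge s(v, w), γ.winding = Real.pi) :
    term (Fc Λ (5 / 8)) v w =
      (1 / (2 * Real.sqrt 3) : ℂ) * Complex.exp (-Complex.I * (Real.pi / 8)) *
        (‖Fc Λ (5 / 8) s(v, w)‖ : ℂ) := by
  have hF : Fc Λ (5 / 8) s(v, w) = _ * (‖Fc Λ (5 / 8) s(v, w)‖ : ℂ) :=
    obs_eq_exp_mul_norm hexCriticalFugacity_pos_lt_one.1.le (5 / 8) Real.pi hW
  have hphase : Complex.I * Complex.exp (-Complex.I * ((5 / 8 : ℝ) : ℂ) * (Real.pi : ℂ)) =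
      Complex.exp (-Complex.I * (Real.pi / 8)) := by
    calc Complex.I * Complex.exp (-Complex.I * ((5 / 8 : ℝ) : ℂ) * (Real.pi : ℂ))
        = Complex.exp (Real.pi / 2 * Complex.I) *
            Complex.exp (-Complex.I * ((5 / 8 : ℝ) : ℂ) * (Real.pi : ℂ)) := by
          rw [Complex.exp_pi_div_two_mul_I]
      _ = Complex.exp (-Complex.I * (Real.pi / 8)) := by
          rw [← Complex.exp_add]
          congr 1
          push_cast
          ring
  have hmid : hexMidpoint s(v, w) - hexCenter v = (hexCenter w - hexCenter v) / 2 := by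
    rw [hexMidpoint_mk]; ring
  rw [term]
  conv_lhs => rw [hF]
  rw [hmid, hvec, Complex.ofReal_inv]
  linear_combination ((Real.sqrt 3 : ℂ)⁻¹ / 2 * (‖Fc Λ (5 / 8) s(v, w)‖ : ℂ)) * hphase

/-- RAY `60°`: dart `e^{-iπ/6}/√3`, winding `-5π/3`, phase `e^{-iπ/6} e^{i25π/24} = e^{i7π/8}
= -e^{-iπ/8}`. [cite: DuminilCopinSmirnov2012, §3 (proof of Lemma 2)] -/
theorem term_raySixty {Λ : Finset HexVertex} {v w : HexVertex}
    (hvec : hexCenter w - hexCenter v =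
      ((Real.sqrt 3)⁻¹ : ℝ) * Complex.exp (-(Real.pi / 6) * Complex.I))
    (hW : ∀ γ : HexMidEdgeSAW Λ cornerEdge s(v, w), γ.winding = -(5 * Real.pi / 3)) :
    term (Fc Λ (5 / 8)) v w =
      -((1 / (2 * Real.sqrt 3) : ℂ) * Complex.exp (-Complex.I * (Real.pi / 8))) *
        (‖Fc Λ (5 / 8) s(v, w)‖ : ℂ) := by
  have hF : Fc Λ (5 / 8) s(v, w) = _ * (‖Fc Λ (5 / 8) s(v, w)‖ : ℂ) :=
    obs_eq_exp_mul_norm hexCriticalFugacity_pos_lt_one.1.le (5 / 8) (-(5 * Real.pi / 3)) hW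
  have hphase : Complex.exp (-(Real.pi / 6) * Complex.I) *
      Complex.exp (-Complex.I * ((5 / 8 : ℝ) : ℂ) * ((-(5 * Real.pi / 3) : ℝ) : ℂ)) =
        -Complex.exp (-Complex.I * (Real.pi / 8)) := by
    rw [← Complex.exp_add, show -Complex.exp (-Complex.I * (Real.pi / 8)) =
        Complex.exp (Real.pi * Complex.I) * Complex.exp (-Complex.I * (Real.pi / 8)) by
          rw [Complex.exp_pi_mul_I]; ring, ← Complex.exp_add]
    congr 1
    push_cast
    ring
  have hmid : hexMidpoint s(v, w) - hexCenter v = (hexCenter w - hexCenter v) / 2 := by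
    rw [hexMidpoint_mk]; ring
  rw [term]
  conv_lhs => rw [hF]
  rw [hmid, hvec, Complex.ofReal_inv]
  linear_combination ((Real.sqrt 3 : ℂ)⁻¹ / 2 * (‖Fc Λ (5 / 8) s(v, w)‖ : ℂ)) * hphase

end FluxLine

open FluxLine in
/-- **The flux line of the marginal reflex cell** (DCS relation summed over `W_N`, boundary
classes evaluated): `Φ_N = (1/(2√3))·(−i − e^{−iπ/8}(Z₀ − Z₆₀))`.
[cite: DuminilCopinSmirnov2012, §3 (proof of Lemma 2, eq. (2))] -/
theorem stub_reflexFluxLine : (∀ (Λ : Finset HexVertex) (N : ℝ), 1 ≤ N → IsReflexWedgeTruncation Λ N → hexDomainSimplyConnected Λ ∧ cornerEdge ∈ hexDomainBoundary Λ ∧ (∀ v w : HexVertex, v ∈ Λ → w ∉ Λ → hexGraph.Adj v w → IsRayZeroDart N v w → hexCenter w - hexCenter v = ((Real.sqrt 3)⁻¹ : ℝ) * Complex.I ∧ ∀ γ : HexMidEdgeSAW Λ cornerEdge s(v, w), γ.winding = Real.pi) ∧ (∀ v w : HexVertex, v ∈ Λ → w ∉ Λ → hexGraph.Adj v w → IsRaySixtyDart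 N v w → hexCenter w - hexCenter v = ((Real.sqrt 3)⁻¹ : ℝ) * Complex.exp (-(Real.pi / 6) * Complex.I) ∧ ∀ γ : HexMidEdgeSAW Λ cornerEdge s(v, w), γ.winding = -(5 * Real.pi / 3))) → ∀ (Λ : Finset HexVertex) (N : ℝ), 1 ≤ N → IsReflexWedgeTruncation Λ N → farFlux Λ N = (1 / (2 * Real.sqrt 3) : ℂ) * (-Complex.I - Complex.exp (-Complex.I * (Real.pi / 8)) * ((rayZeroMass Λ N - raySixtyMass Λ N : ℝ) : ℂ)) := by
  intro hG Λ N hN hΛ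
  obtain ⟨hsc, hbd, h0, h60⟩ := hG Λ N hN hΛ
  have hrel : SatisfiesVertexRelations Λ (Fc Λ (5 / 8)) :=
    DuminilCopinSmirnov2012_lemma1_holds Λ hsc cornerEdge hbd
  have hflux := hexFlux_eq_zero_of_satisfiesVertexRelations hrel
  rw [hexFlux_decomp hN hΛ hbd, term_root hbd] at hflux
  have hfar : dartSum Λ (IsArcDart N) (term (Fc Λ (5 / 8))) = farFlux Λ N := rfl
  have hZ0 : dartSum Λ (IsRayZeroDart N) (term (Fc Λ (5 / 8))) =
      (1 / (2 * Real.sqrt 3) : ℂ) * Complex.exp (-Complex.I * (Real.pi / 8)) *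
        (rayZeroMass Λ N : ℂ) := by
    rw [rayZeroMass, ofReal_dartSum, ← dartSum_const_mul]
    exact dartSum_congr_fun fun v hv w hadj hw hP =>
      term_rayZero (h0 v w hv hw hadj hP).1 (h0 v w hv hw hadj hP).2
  have hZ60 : dartSum Λ (IsRaySixtyDart N) (term (Fc Λ (5 / 8))) =
      -((1 / (2 * Real.sqrt 3) : ℂ) * Complex.exp (-Complex.I * (Real.pi / 8))) *
        (raySixtyMass Λ N : ℂ) := by
    rw [raySixtyMass, ofReal_dartSum, ← dartSum_const_mul]
    exact dartSum_congr_fun fun v hv w hadj hw hP =>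
      term_raySixty (h60 v w hv hw hadj hP).1 (h60 v w hv hw hadj hP).2
  rw [hfar, hZ0, hZ60] at hflux
  push_cast at hflux ⊢
  linear_combination hflux

end Summit.CriticalPhenomena.SAWScalingLimit.Theorems.HexConjecture.MarginalWedge

end
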